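import Literature.Barriers.NavierStokesRegularity.NavierStokesInequalityCantorArrangement
import Literature.Barriers.NavierStokesRegularity.NavierStokesInequalityStructureTranslate
import Literature.MeasureTheory.Hausdorff.SelfSimilarCodeWords
import HarnessLib

/-!
MAINTENANCE 2026-08-20 (ops-buildfix lane): `disjoint_translate` is now `disjoint_translate'` in this file — the unprimed fully-qualified name is ALSO
declared (a different variant of the same cited statement) in `NavierStokesInequalityCantorBlockOfArrangementHolds.lean`, and two modules declaring one name cannot be
co-imported (this broke the `Literature` root aggregate). Only the name changed; statement and proof are byte-identical.

# The `Mʲ` translates of a Cantor arrangement are pairwise disjoint (Ożański 2017, §6.3 Step 1)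

Support file on the discharge path of fact D′
`Literature.Barriers.NavierStokesRegularity.NSICantorBlock_of_arrangement`. W. S. Ożański,
arXiv:1709.00602v4, §6.3 Step 1 (p. 30): "the sets `K^𝔪` are pairwise disjoint translates of
`Ū₁ ∪ Ū₂` in the `x₁` direction … (just as each element of the union `⋃_{m∈M(j)} Γ_m(G)` is
separated from the rest …)". In the tree's rendering (`NavierStokesInequalityCantorArrangement`)
the `m`-th translate, `m : Fin j → Fin M`, is `G + levelShift τ X z m • eZ`, the image of the
generation piece `Γ_m(G)` under the un-rescaling `x ↦ τ^{-j}(x - c_j)` of (6.13)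
(`word_cantorTranslate_eq`). PROVED here: the translates in space
(`IsNSICantorArrangement.disjoint_translate'`) and in the meridian plane
(`IsNSICantorArrangement.disjoint_translate_plane`) are pairwise disjoint for distinct words —
from (6.3) (`disjoint_image`), `Γ_n(G) ⊆ G` (`mapsTo`) and the word combinatorics of
`CantorDust.disjoint_image_word` — together with the dictionary
`R(K + (0,s)) = R(K) + s eZ` (`revolve_image_add_axial`). This is the disjointness clause of the
multi-profile data (`IsNSIMultiProfileData.disjoint`) for the translated structures of Step 1.

## References

* W. S. Ożański, *On weak solutions to the Navier–Stokes inequality with internal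
  singularities*, arXiv:1709.00602v4, §6.1 (`Γ_m(G) ∩ Γ_{m̃}(G) = ∅`), §6.3 Step 1.
  [`Ozanski2017NSISingular`]
* V. Scheffer, Comm. Math. Phys. 110 (1987), §5, (5.26)–(5.33). [`Scheffer1987`]
-/

noncomputable section

open Set Function
open Literature.MeasureTheory.Hausdorff

namespace Literature.Barriers.NavierStokesRegularity

open Literature.Analysis.FluidPDE

/-- **The solid of a translated planar set is the translated solid**: `R(K + (0,s)) = R(K) + s eZ`
(the meridian projection intertwines axial translations). [cite: Ozanski2017NSISingular, §6.3 Step 1] -/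
theorem revolve_image_add_axial (K : Set (ℝ × ℝ)) (s : ℝ) :
    revolve ((fun q : ℝ × ℝ => q + (0, s)) '' K) =
      (fun x : (EuclideanSpace ℝ (Fin 3)) => x + s • EuclideanSpace.single 2 1) '' revolve K := by
  have hs : (EuclideanSpace.single (2 : Fin 3) (1 : ℝ) : (EuclideanSpace ℝ (Fin 3))) = eZ := rfl
  ext x
  simp only [mem_revolve, mem_image]
  constructor
  · rintro ⟨q, hq, hqx⟩
    refine ⟨x + (-s) • EuclideanSpace.single 2 1, ?_, ?_⟩
    · have hm : meridian (x + (-s) • eZ) = q := by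
        rw [meridian_add_smul_eZ, ← hqx]
        ext <;> simp
      rw [hs, hm]
      exact hq
    · rw [hs, add_assoc, ← add_smul, neg_add_cancel, zero_smul, add_zero]
  · rintro ⟨y, hy, rfl⟩
    exact ⟨meridian y, hy, by rw [hs, meridian_add_smul_eZ]⟩

/-- Planar sets in the closed half-plane with disjoint solids are disjoint. [folklore] -/
theorem disjoint_of_disjoint_revolve {K K' : Set (ℝ × ℝ)} (hK : K ⊆ {q | 0 ≤ q.1})
    (h : Disjoint (revolve K) (revolve K')) : Disjoint K K' := by
  rw [Set.disjoint_left] at h ⊢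
  intro q hq hq'
  have hm : meridian (meridianPoint q) = q := meridian_meridianPoint (hK hq)
  exact h (show meridianPoint q ∈ revolve K by rw [mem_revolve, hm]; exact hq)
    (show meridianPoint q ∈ revolve K' by rw [mem_revolve, hm]; exact hq')

namespace IsNSICantorArrangement

variable {U₁ U₂ : Set (ℝ × ℝ)} {v₁ : ℝ × ℝ → ℝ × ℝ} {f₁ φ₁ : ℝ × ℝ → ℝ} {v₂ : ℝ × ℝ → ℝ × ℝ}
  {f₂ φ₂ : ℝ × ℝ → ℝ} {T τ : ℝ} {M : ℕ} {X : ℝ} {z : (EuclideanSpace ℝ (Fin 3))}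

/-- **The pieces of one generation are pairwise disjoint**: `Γ_m(G) ∩ Γ_{m'}(G) = ∅` for words
`m ≠ m'` of the same length (Ożański §6.1, from (6.3) and `Γ_n(G) ⊆ G`).
[cite: Ozanski2017NSISingular, §6.1] -/
theorem disjoint_image_word (hA : IsNSICantorArrangement U₁ U₂ v₁ f₁ φ₁ v₂ f₂ φ₂ T τ M X z)
    {j : ℕ} {m m' : Fin j → Fin M} (hne : m ≠ m') :
    Disjoint (CantorDust.word τ (cantorTranslate X z M) m '' revolve (closure U₁ ∪ closure U₂))
      (CantorDust.word τ (cantorTranslate X z M) m' '' revolve (closure U₁ ∪ closure U₂)) :=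
  CantorDust.disjoint_image_word hA.τ_pos.ne' hA.mapsTo hA.disjoint_image hne

/-- **The `Mʲ` axial translates `G + levelShift τ X z m • eZ` of `G = R(Ū₁ ∪ Ū₂)` are pairwise
disjoint** (Ożański §6.3 Step 1: "the sets `K^𝔪` are pairwise disjoint translates of `Ū₁ ∪ Ū₂`
in the `x₁` direction"): the translate is the image of `Γ_m(G)` under the injective un-rescaling
of (6.13). [cite: Ozanski2017NSISingular, §6.3 Step 1] -/
theorem disjoint_translate' (hA : IsNSICantorArrangement U₁ U₂ v₁ f₁ φ₁ v₂ f₂ φ₂ T τ M X z)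
    {j : ℕ} {m m' : Fin j → Fin M} (hne : m ≠ m') :
    Disjoint
      ((fun y : (EuclideanSpace ℝ (Fin 3)) => y + levelShift τ X z m • EuclideanSpace.single 2 1) ''
        revolve (closure U₁ ∪ closure U₂))
      ((fun y : (EuclideanSpace ℝ (Fin 3)) => y + levelShift τ X z m' • EuclideanSpace.single 2 1) ''
        revolve (closure U₁ ∪ closure U₂)) := by
  have hτ := hA.τ_pos
  -- the rescaling `x ↦ c_j + τʲ x` is injective and maps the translates onto the pieces `Γ_m(G)`
  set Φ : (EuclideanSpace ℝ (Fin 3)) → (EuclideanSpace ℝ (Fin 3)) := fun x => levelCenter τ z j + τ ^ j • x with hΦ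
  have hinj : Injective Φ := fun x y hxy =>
    smul_right_injective (EuclideanSpace ℝ (Fin 3)) (pow_ne_zero j hτ.ne') (add_left_cancel hxy)
  have e : ∀ m'' : Fin j → Fin M,
      Φ '' ((fun y : (EuclideanSpace ℝ (Fin 3)) => y + levelShift τ X z m'' • EuclideanSpace.single 2 1) ''
        revolve (closure U₁ ∪ closure U₂)) =
        CantorDust.word τ (cantorTranslate X z M) m'' '' revolve (closure U₁ ∪ closure U₂) := by
    intro m''
    rw [image_image]
    exact image_congr fun y _ => (word_cantorTranslate_eq hτ.ne' X z m'' y).symm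
  rw [← disjoint_image_iff hinj, e m, e m']
  exact hA.disjoint_image_word hne

/-- **Planar form**: the translates `(Ū₁ ∪ Ū₂) + (0, levelShift τ X z m)` of the planar data in
the meridian half-plane are pairwise disjoint for distinct words (the sets `K^𝔪` of Step 1).
[cite: Ozanski2017NSISingular, §6.3 Step 1] -/
theorem disjoint_translate_plane (hA : IsNSICantorArrangement U₁ U₂ v₁ f₁ φ₁ v₂ f₂ φ₂ T τ M X z)
    {j : ℕ} {m m' : Fin j → Fin M} (hne : m ≠ m') :
    Disjoint ((fun q : ℝ × ℝ => q + (0, levelShift τ X z m)) '' (closure U₁ ∪ closure U₂))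
      ((fun q : ℝ × ℝ => q + (0, levelShift τ X z m')) '' (closure U₁ ∪ closure U₂)) := by
  refine disjoint_of_disjoint_revolve ?_ ?_
  · rintro _ ⟨q, hq, rfl⟩
    have hq1 : 0 < q.1 := by
      rcases hq with hq | hq
      · exact hA.structure₁.closure_subset hq
      · exact hA.structure₂.closure_subset hq
    simpa using hq1.le
  · rw [revolve_image_add_axial, revolve_image_add_axial]
    exact hA.disjoint_translate' hne

/-- **Any two distinct translated pieces are disjoint**: for `(m, K)`, `(m', K')` with
`K, K' ∈ {Ū₁, Ū₂}` and `(m, K) ≠ (m', K')`, the planar translates `K + (0, levelShift m)` and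
`K' + (0, levelShift m')` are disjoint (different words: `disjoint_translate_plane`; the same
word: `Ū₁ ∩ Ū₂ = ∅` translated). [cite: Ozanski2017NSISingular, §6.3 Step 1] -/
theorem disjoint_translate_closure (hA : IsNSICantorArrangement U₁ U₂ v₁ f₁ φ₁ v₂ f₂ φ₂ T τ M X z)
    {j : ℕ} {m m' : Fin j → Fin M} {K K' : Set (ℝ × ℝ)}
    (hK : K = closure U₁ ∨ K = closure U₂) (hK' : K' = closure U₁ ∨ K' = closure U₂)
    (hne : m ≠ m' ∨ K ≠ K') :
    Disjoint ((fun q : ℝ × ℝ => q + (0, levelShift τ X z m)) '' K)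
      ((fun q : ℝ × ℝ => q + (0, levelShift τ X z m')) '' K') := by
  have hKs : K ⊆ closure U₁ ∪ closure U₂ := by
    rcases hK with rfl | rfl
    exacts [subset_union_left, subset_union_right]
  have hK's : K' ⊆ closure U₁ ∪ closure U₂ := by
    rcases hK' with rfl | rfl
    exacts [subset_union_left, subset_union_right]
  by_cases hm : m = m'
  · subst hm
    have hKK' : K ≠ K' := hne.resolve_left (fun h => h rfl)
    have hd : Disjoint K K' := by
      rcases hK with rfl | rfl <;> rcases hK' with rfl | rfl
      · exact (hKK' rfl).elim
      · exact hA.disjoint_closure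
      · exact hA.disjoint_closure.symm
      · exact (hKK' rfl).elim
    exact (disjoint_image_iff (add_left_injective _)).2 hd
  · exact (hA.disjoint_translate_plane hm).mono (image_mono hKs) (image_mono hK's)

end IsNSICantorArrangement

end Literature.Barriers.NavierStokesRegularity
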